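import Summits.ResolutionOfSingularities.ResolutionOfSingularities.Theorems.MarkedTransferCampaignW31RegularCut
import Summits.ResolutionOfSingularities.ResolutionOfSingularities.Theorems.MarkedTransferCampaignW31UscFiniteDegree
import Literature.AlgebraicGeometry.Hironaka2017.Proofs.S06BaseHike.U30L4
import HarnessLib

/-!
# [OURS · L1 W3.1 → D-lane §M] The apex modulus «existence of `Ě`» (`S06BaseHike.U30_2_R2_inst`) FROM the W3.1 slot
# statement and the named G3 residual — the composition named by res-L1-type-o4 (MODULUS NOTE 2026-08-27T00:20:42Z)

Cell `res-hironaka`, rung L, slot W3.1 (seat res-L1-s31-pv-2). With p476257 (`Theorems/MarkedTransferCampaignW31RegularCut.lean`)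
in the tree, the premise ⟨RegularCut⟩ of GAP-LEDGER R12/12a (typed `S06BaseHike.RegularCut_ours`, R010e p472988; it yields the
existence of `Ě` in the typed sense `S06BaseHike.U30_2_R2_inst`, `U30_2_R2_inst_of_regularCut` p473407) is, at the Def. 4.9
provenance `CampaignW31.edgeDataProvenance`, the conjunction of the CLOSEDNESS half (delivered by slot W3.1 «u.s.c. of `Inv`»)
and the REGULARITY half `CampaignW31HatClosureRegularI p` (the open residual of record). The slot delivers the closedness half
only under the guard `0 < b̂` (`campaignW31HatStratumClosedI_of_invmaxClosedI`), which is `U30_2_R2_inst`'s own guard; so the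
composition goes per `(E, ed)`:

* `CampaignW31.U30_2_R2_inst_of_usc_and_closureRegular` — `CampaignW31UscInvOneExponentI p → CampaignW31HatClosureRegularI p →
  ∀ K A n, U30_2_R2_inst edgeDataProvenance A n` (per `(E, ed)`: closedness half from p467881/p476257, regularity half from the
  residual, `regularCutOn_iff`, then `Lib.CoreFocusCutDown.exists_isCoreFocus_ambient`);
* `CampaignW31.U30_2_R2_inst_of_dictionary_and_closureRegular` — the same with the slot statement replaced by its remaining
  input, the dictionary (ii) `CampaignW31EdgeHilbDictionary p` (seat pv-1's `campaignW31UscInvOneExponentI_of_dictionary`,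
  p475766, built on `CampaignW31EdgeHilbLsc_holds`, p474858).

HONEST FRAMING. Pure logic over OURS statements and tree theorems; NOTHING here is a statement of H. Hironaka's manuscript
[Hironaka2017] and nothing of it is asserted. `CampaignW31HatClosureRegularI p` is a CANDIDATE premise with no argument on record
either way. AI bookkeeping; weaker than expert review.
-/

set_option linter.dupNamespace false -- mandated namespace of this single-conjunct summit

open _root_.AlgebraicGeometry _root_.TopologicalSpace

namespace Summit.ResolutionOfSingularities.ResolutionOfSingularities.Theorems

open Literature.AlgebraicGeometry.Resolution
open Literature.AlgebraicGeometry.Hironaka2017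
open Literature.AlgebraicGeometry.Hironaka2017.S02Preliminaries
open Literature.AlgebraicGeometry.Hironaka2017.S04CharAlgebra
open Literature.AlgebraicGeometry.Hironaka2017.S06BaseHike
open Literature.AlgebraicGeometry.Hironaka2017.Datum

universe u

namespace CampaignW31

/-- **[OURS · L1 W3.1 → D-lane] existence of `Ě` (typed `U30_2_R2_inst` at the Def. 4.9 provenance) FROM the W3.1 slot statement
and the regularity residual**: per `(E, ed)` with `0 < b̂`, the closedness half (`campaignW31HatStratumClosedI_of_invmaxClosedI` ∘
`campaignW31InvmaxClosedI_of_uscInvOneExponentI`) and the regularity half give a regular cut (`regularCutOn_iff`), whence a core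
focus by the cut-down construction (`exists_isCoreFocus_ambient`). NOT a statement of the manuscript. [folklore] -/
theorem U30_2_R2_inst_of_usc_and_closureRegular (p : ℕ) [Fact p.Prime]
    (h₁ : CampaignW31UscInvOneExponentI.{u} p) (h₂ : CampaignW31HatClosureRegularI.{u} p)
    (K : Type u) [Field K] [CharP K p] [PerfectField K] (A : AmbientDatum p K) (n : ℕ) :
    U30_2_R2_inst CampaignW31.edgeDataProvenance A n := by
  intro E hE _ hd ed hed _
  have hclosed := campaignW31HatStratumClosedI_of_invmaxClosedI p
    (campaignW31InvmaxClosedI_of_uscInvOneExponentI p h₁) K A n E ed hE hd hed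
  have hreg := h₂ K A n E ed hE hed
  have hcut : RegularCutOn ((baseHike E).sing ∩ S02Preliminaries.closedPoints A.Z) (invField (baseHike E) ed) :=
    (regularCutOn_iff _ _).mpr ⟨hclosed, hreg⟩
  exact exists_isCoreFocus_ambient A (invInst (baseHike E) ed) (baseHike E) hd hcut

/-- **[OURS · L1 W3.1 → D-lane] existence of `Ě` FROM THE DICTIONARY and the regularity residual**: the slot statement follows
from the dictionary (ii) alone (seat pv-1, p475766, with (i) `CampaignW31EdgeHilbLsc_holds`), so
`CampaignW31EdgeHilbDictionary p → CampaignW31HatClosureRegularI p → ∀ K A n, U30_2_R2_inst edgeDataProvenance A n`.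
NOT a statement of the manuscript. [folklore] -/
theorem U30_2_R2_inst_of_dictionary_and_closureRegular (p : ℕ) [Fact p.Prime]
    (hdict : CampaignW31EdgeHilbDictionary.{u} p) (h₂ : CampaignW31HatClosureRegularI.{u} p)
    (K : Type u) [Field K] [CharP K p] [PerfectField K] (A : AmbientDatum p K) (n : ℕ) :
    U30_2_R2_inst CampaignW31.edgeDataProvenance A n :=
  U30_2_R2_inst_of_usc_and_closureRegular p (campaignW31UscInvOneExponentI_of_dictionary p hdict) h₂ K A n

end CampaignW31

end Summit.ResolutionOfSingularities.ResolutionOfSingularities.Theorems
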